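import Summits.PneNP.PneNP.Theses.OneSlice
import Summits.PneNP.PneNP.Theorems.ConstantBand.Negative.LoadBearing
import Summits.PneNP.PneNP.Theorems.SliceACZero.Negative.DeltaBeforeK
import Summits.PneNP.PneNP.Theorems.SingleThreshold.Negative.LoadBearing

/-!
# `SliceTarget` (stmt-PneNP-2832, route PneNP/OneSlice, the target X) — negative-side lemmas I: read-back, bridge to
# rung #3 at width `0`, load-bearing hypotheses, redundancy of the guard `3 ≤ k`

Standing-adversary (cdisprove) output for the crux `Summit.PneNP.PneNP.Theses.OneSlice.SliceTarget`:
`∀ c, ∃ k ≥ 3, ∃ δ > 0, ∀ᶠ n, ∀ j` central (`|j - m_k(n)| ≤ m_k(n)^{3/4}`), `∀ C` over `{∧₂, ∨₂}`: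
`#{x : e(x) = j, C(x) ≠ CLIQUE_k(x)} ≤ δ·#{x : e(x) = j} ⟹ n^c < |C|`.
The crux is NOT refuted and NOT mis-stated; this file records, as theorems, what any proof must use and what a kill must deliver:

* §0 `sliceTarget_iff` (`Iff.rfl` read-back, schedule form `SliceLB c k δ`), `sliceLB_iff_bandLB_zero` /
  `sliceTarget_iff_bandLB_zero` (**X is `ConstantBand` frozen at width `w = 0`**: every `w = 0` instance of a negative lemma on
  rung #3 is a lemma on X, and `TargetImpliesBand` is one line), `not_sliceTarget_iff` (what a kill must deliver),
  `SliceLB.anti_delta` / `anti_exp`.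
* §1 `sliceTarget_false_without_basis` (one table gate, `c = 0`), `sliceTarget_false_without_central` with both ends —
  `not_sliceLBNoWindow_bottom` (`j = 0`, `x_e`, exponent `0`, every `k ≥ 2`, `δ ≥ 0`) and `not_sliceLBNoWindow_top`
  (`j = C(n,2)`, OR of all edges, exponent `2`) —, `sliceTarget_false_without_accuracy`; and `three_le_of_sliceLB`: the guard
  `3 ≤ k` is redundant (`k = 0, 1, 2` can never witness: `thr_zero`, `thr_one`, `thr_two`, `central_two_iff`).

Companions: `WitnessShape.lean` (`k ≥ c+1`, `δ ≤ 1/k!`, three quantifier-order strengthenings refuted),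
`GeneralCircuits.lean` (X ↔ its `B₂` form modulo `SliceMonotonization`; the weakenings `Exact`/`IO` that still close the route).
Work file with the running commentary (why X resists, what was not attempted): `Summits/PneNP/PneNP/Cruxes/SliceTarget/Disproof.lean`.
Refuter seat cdisprove-stmt-PneNP-2832 (gen 1), 2026-08-16.
-/

set_option linter.dupNamespace false

namespace Summit.PneNP.PneNP.Theorems.SliceTarget.Negative

open Literature.Computability.Complexity Filter Finset Classical
open Summit.PneNP.PneNP.Theses.OneSlice (SliceTarget ConstantBand SliceMonotonization)
open Summit.PneNP.PneNP.Theorems.ConstantBand.Negative (Edge thr Central central_thr slice errSet bandErr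
  BandLB bandErr_eq_zero_of_eval exists_oneGate_cliqueFn cliqueFn_eq_true_of_card_false_le le_choose_two
  exists_orAll)
open Summit.PneNP.PneNP.Theorems.SliceACZero.Negative (mk sliceCard sliceErr sliceCard_eq card_slice_supset_le
  choose_sub_mul_pow_le_choose_mul_pow firstMoment_slice mk_le_choose choose_le_edgeCount_of_cliqueFn
  eq_false_of_edgeCount_eq_zero eq_true_of_edgeCount_eq cliqueFn_false cliqueFn_true exists_edge input_facts
  factorial_inv_le_of_ceil_lt)
open Summit.PneNP.PneNP.Theorems.SingleThreshold.Negative (pc pc_nonneg pc_le_one tendsto_pc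
  exists_monotone_cliqueCircuit choose_mul_le_pow)

/-! ## §0 Read-back, schedule form, bridge to `ConstantBand` at width `0` -/

/-- The crux at fixed parameters `(c, k, δ)`: eventually in `n`, every `{∧₂, ∨₂}`-circuit that errs on at
most a `δ`-fraction of a central slice `j` has more than `n^c` gates. [folklore] -/
def SliceLB (c k : ℕ) (δ : ℝ) : Prop :=
  ∀ᶠ n : ℕ in atTop, ∀ j : ℕ, Central k n j → ∀ C : Circuit (Edge n), C.IsOver monotoneBasis →
    (#(errSet n k j C) : ℝ) ≤ δ * #(slice n j) → n ^ c < C.size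

/-- **Read-back.** The crux is `∀ c, ∃ k ≥ 3, ∃ δ > 0, SliceLB c k δ` — definitionally (the inline clique
function is `cliqueFn`, the inline edge count is `edgeCount`, the inline threshold is `thr`). [folklore] -/
theorem sliceTarget_iff : SliceTarget ↔ ∀ c : ℕ, ∃ k : ℕ, 3 ≤ k ∧ ∃ δ : ℝ, 0 < δ ∧ SliceLB c k δ :=
  Iff.rfl

/-- Vocabulary check: `thr k n` (ConstantBand lane) is `mk n k` (SliceACZero lane). [folklore] -/
theorem thr_eq_mk (k n : ℕ) : thr k n = mk n k := rfl

/-- Vocabulary check: `#(slice n j)` is `sliceCard n j`. [folklore] -/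
theorem card_slice_eq_sliceCard (n j : ℕ) : #(slice n j) = sliceCard n j := rfl

/-- Vocabulary check: `#(errSet n k j C)` is `sliceErr n j C.eval (cliqueFn n k)`. [folklore] -/
theorem card_errSet_eq_sliceErr (n k j : ℕ) (C : Circuit (Edge n)) :
    #(errSet n k j C) = sliceErr n j C.eval (cliqueFn n k) := rfl

/-- The error set lives in its slice. [folklore] -/
theorem errSet_subset_slice (n k j : ℕ) (C : Circuit (Edge n)) : errSet n k j C ⊆ slice n j :=
  fun _ hx => mem_filter.2 ⟨mem_univ _, (mem_filter.1 hx).2.1⟩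

/-- Slices above `C(n,2)` are empty (`#slice_j = C(C(n,2), j)` is the SliceACZero lane's `sliceCard_eq`). [folklore] -/
theorem card_slice_eq_zero {n j : ℕ} (h : n.choose 2 < j) : #(slice n j) = 0 := by
  rw [card_slice_eq_sliceCard, sliceCard_eq, Nat.choose_eq_zero_of_lt h]

/-- An error set is empty when the circuit is right on the slice. [folklore] -/
theorem errSet_eq_empty_of {n k j : ℕ} {C : Circuit (Edge n)}
    (h : ∀ x : Edge n → Bool, edgeCount x = j → C.eval x = cliqueFn n k x) : errSet n k j C = ∅ :=
  filter_eq_empty_iff.2 fun x _ hx => hx.2 (h x hx.1)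

/-- Circuits that agree on the slice have the same error set there. [folklore] -/
theorem errSet_congr {n k j : ℕ} {C C' : Circuit (Edge n)}
    (h : ∀ x : Edge n → Bool, edgeCount x = j → C'.eval x = C.eval x) : errSet n k j C' = errSet n k j C := by
  refine filter_congr fun x _ => ?_
  constructor
  · rintro ⟨hj, hne⟩; exact ⟨hj, by rwa [← h x hj]⟩
  · rintro ⟨hj, hne⟩; exact ⟨hj, by rwa [h x hj]⟩

/-- **Bridge to rung #3 at width `0`.** Slice accuracy `#err_j ≤ δ·#slice_j` IS band accuracy
`bandErr n k j 0 C ≤ δ` (for `δ ≥ 0`; on an empty slice both are vacuous). [folklore] -/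
theorem sliceAcc_iff_bandErr_zero {n k j : ℕ} {δ : ℝ} (hδ : 0 ≤ δ) (C : Circuit (Edge n)) :
    (#(errSet n k j C) : ℝ) ≤ δ * #(slice n j) ↔ bandErr n k j 0 C ≤ δ := by
  have hb : bandErr n k j 0 C = (#(errSet n k j C) : ℝ) / #(slice n j) := by
    rw [bandErr, Nat.sub_zero, Nat.add_zero, Icc_self, sum_singleton]
  rw [hb]
  by_cases hs : #(slice n j) = 0
  · have he : #(errSet n k j C) = 0 :=
      Nat.eq_zero_of_le_zero (hs ▸ card_le_card (errSet_subset_slice n k j C))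
    rw [he, hs]; simp [hδ]
  · have hs' : (0 : ℝ) < #(slice n j) := by exact_mod_cast Nat.pos_of_ne_zero hs
    rw [div_le_iff₀ hs']

/-- `SliceLB c k δ` is `BandLB c k 0 δ` (`δ ≥ 0`). [folklore] -/
theorem sliceLB_iff_bandLB_zero {c k : ℕ} {δ : ℝ} (hδ : 0 ≤ δ) : SliceLB c k δ ↔ BandLB c k 0 δ := by
  constructor
  · intro H
    filter_upwards [H] with n hn j hj C hC herr
    exact hn j hj C hC ((sliceAcc_iff_bandErr_zero hδ C).2 herr)
  · intro H
    filter_upwards [H] with n hn j hj C hC herr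
    exact hn j hj C hC ((sliceAcc_iff_bandErr_zero hδ C).1 herr)

/-- **`SliceTarget` is `ConstantBand` with the width frozen at `w = 0`**: so `TargetImpliesBand` (item 2838)
is one line, and every `w = 0` instance of a negative lemma on rung #3 is a lemma on X. [folklore] -/
theorem sliceTarget_iff_bandLB_zero :
    SliceTarget ↔ ∀ c : ℕ, ∃ k : ℕ, 3 ≤ k ∧ ∃ δ : ℝ, 0 < δ ∧ BandLB c k 0 δ := by
  rw [sliceTarget_iff]
  refine forall_congr' fun c => exists_congr fun k => and_congr_right fun _ =>
    exists_congr fun δ => and_congr_right fun hδ => sliceLB_iff_bandLB_zero hδ.le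

/-- Smaller `δ` = weaker claim. [folklore] -/
theorem SliceLB.anti_delta {c k : ℕ} {δ δ' : ℝ} (h : δ' ≤ δ) (H : SliceLB c k δ) : SliceLB c k δ' := by
  filter_upwards [H] with n hn j hj C hC herr
  exact hn j hj C hC (herr.trans (mul_le_mul_of_nonneg_right h (Nat.cast_nonneg _)))

/-- Smaller exponent = weaker claim. [folklore] -/
theorem SliceLB.anti_exp {c c' k : ℕ} {δ : ℝ} (h : c' ≤ c) (H : SliceLB c k δ) : SliceLB c' k δ := by
  filter_upwards [H, eventually_ge_atTop 1] with n hn h1 j hj C hC herr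
  exact lt_of_le_of_lt (Nat.pow_le_pow_right h1 h) (hn j hj C hC herr)

/-- Negation of the schedule form. [folklore] -/
theorem not_sliceLB_iff {c k : ℕ} {δ : ℝ} :
    ¬ SliceLB c k δ ↔ ∃ᶠ n : ℕ in atTop, ∃ j : ℕ, Central k n j ∧ ∃ C : Circuit (Edge n),
      C.IsOver monotoneBasis ∧ (#(errSet n k j C) : ℝ) ≤ δ * #(slice n j) ∧ C.size ≤ n ^ c := by
  rw [SliceLB, not_eventually]
  constructor
  · intro h
    refine h.mono fun n hn => ?_
    by_contra hcon
    apply hn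
    intro j hj C hC herr
    by_contra hlt
    exact hcon ⟨j, hj, C, hC, herr, not_lt.1 hlt⟩
  · intro h
    refine h.mono fun n hn hall => ?_
    obtain ⟨j, hj, C, hC, herr, hs⟩ := hn
    exact absurd (hall j hj C hC herr) (not_lt.2 hs)

/-- **What a kill must deliver**: ONE exponent `c` and, for EVERY `k ≥ 3` and EVERY `δ > 0`, infinitely many
`n` with a central `j` and a monotone circuit of size `≤ n^c` erring on `≤ δ·#slice_j` graphs of slice `j`. [folklore] -/
theorem not_sliceTarget_iff :
    ¬ SliceTarget ↔ ∃ c : ℕ, ∀ k : ℕ, 3 ≤ k → ∀ δ : ℝ, 0 < δ →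
      ∃ᶠ n : ℕ in atTop, ∃ j : ℕ, Central k n j ∧ ∃ C : Circuit (Edge n), C.IsOver monotoneBasis ∧
        (#(errSet n k j C) : ℝ) ≤ δ * #(slice n j) ∧ C.size ≤ n ^ c := by
  rw [sliceTarget_iff]
  push Not
  simp only [not_sliceLB_iff]

/-- The gate-free projection `x_e` has size `0`, is over every basis, and reads `x e`. [folklore] -/
theorem input_isOver {n : ℕ} (e : Edge n) (B : Set GateFn) : (Circuit.input e).IsOver B :=
  (input_facts e B).1

/-! ## §1 Load-bearing hypotheses

The crux has four hypotheses on the data `(j, C)`: the WINDOW `Central k n j`, the BASIS `C.IsOver monotoneBasis`,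
the ACCURACY `#err ≤ δ·#slice`, and the guard `3 ≤ k` on the witness. The first three are load-bearing (each
dropped version — stated INLINE below; the work file names them `SliceTargetWithout…` — is refuted by a circuit with at
most `C(n,2)` gates); the guard `3 ≤ k` is REDUNDANT (`three_le_of_sliceLB`: no `k ≤ 2` can witness anyway). -/

/-- **The basis restriction is load-bearing**: the crux with the hypothesis `C.IsOver monotoneBasis` dropped
(arbitrary gates of arbitrary fan-in; `SliceTargetWithoutBasis` in the work file) is FALSE — one gate of fan-in `C(n,2)`
whose table is `CLIQUE_k` is exact on every slice (size `1`), so it fails already at `c = 0`. [folklore] -/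
theorem sliceTarget_false_without_basis :
    ¬ ∀ c : ℕ, ∃ k : ℕ, 3 ≤ k ∧ ∃ δ : ℝ, 0 < δ ∧ ∀ᶠ n : ℕ in atTop, ∀ j : ℕ, Central k n j →
      ∀ C : Circuit (Edge n), (#(errSet n k j C) : ℝ) ≤ δ * #(slice n j) → n ^ c < C.size := by
  intro h
  obtain ⟨k, -, δ, hδ, hev⟩ := h 0
  obtain ⟨n, hn⟩ := hev.exists
  obtain ⟨C, hs, he⟩ := exists_oneGate_cliqueFn n k
  have hlt := hn (thr k n) (central_thr k n) C
    (by rw [errSet_eq_empty_of fun x _ => he x, card_empty, Nat.cast_zero]; positivity)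
  simp only [pow_zero] at hlt
  omega

/-- The inner clause with the WINDOW dropped (every edge count `j`), at parameters `(c, k, δ)`. [folklore] -/
def SliceLBNoWindow (c k : ℕ) (δ : ℝ) : Prop :=
  ∀ᶠ n : ℕ in atTop, ∀ j : ℕ, ∀ C : Circuit (Edge n), C.IsOver monotoneBasis →
    (#(errSet n k j C) : ℝ) ≤ δ * #(slice n j) → n ^ c < C.size

/-- **Bottom end** (`j = 0`, exponent `0`, every `k ≥ 2`, `δ ≥ 0`): the only graph of slice `0` is empty,
`CLIQUE_k(∅) = 0 = x_e`, so the gate-free circuit `x_e` is EXACT there — no window, no lower bound. [folklore] -/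
theorem not_sliceLBNoWindow_bottom (c : ℕ) {k : ℕ} (hk : 2 ≤ k) {δ : ℝ} (hδ : 0 ≤ δ) :
    ¬ SliceLBNoWindow c k δ := by
  intro H
  obtain ⟨n, hn, hn2⟩ := (H.and (eventually_ge_atTop 2)).exists
  obtain ⟨e₀⟩ := exists_edge hn2
  have hexact : ∀ x : Edge n → Bool, edgeCount x = 0 → (Circuit.input e₀).eval x = cliqueFn n k x := by
    intro x hx
    rw [eq_false_of_edgeCount_eq_zero hx, Circuit.eval_input, cliqueFn_false hk]
  have hlt := hn 0 (Circuit.input e₀) (input_isOver e₀ _)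
    (by rw [errSet_eq_empty_of hexact, card_empty, Nat.cast_zero]; positivity)
  rw [Circuit.size_input] at hlt
  exact Nat.not_lt_zero _ hlt

/-- **Top end** (`j = C(n,2)`, exponent `2`, every `k`, `δ ≥ 0`): the only graph of the top slice is `K_n`,
`CLIQUE_k(K_n) = 1` (`n ≥ k`) and the OR of all edges (`≤ C(n,2) < n²` gates) is `1` there. [folklore] -/
theorem not_sliceLBNoWindow_top {c : ℕ} (hc : 2 ≤ c) (k : ℕ) {δ : ℝ} (hδ : 0 ≤ δ) :
    ¬ SliceLBNoWindow c k δ := by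
  intro H
  obtain ⟨n, hn, hnk⟩ := (H.and (eventually_ge_atTop (k + 2))).exists
  obtain ⟨C, hCB, hs, he⟩ := exists_orAll n (by omega)
  obtain ⟨e₀⟩ := exists_edge (by omega : 2 ≤ n)
  have hexact : ∀ x : Edge n → Bool, edgeCount x = n.choose 2 → C.eval x = cliqueFn n k x := by
    intro x hx
    rw [eq_true_of_edgeCount_eq hx, cliqueFn_true (by omega : k ≤ n)]
    exact (he _).2 ⟨e₀, rfl⟩
  have hlt := hn (n.choose 2) C hCB
    (by rw [errSet_eq_empty_of hexact, card_empty, Nat.cast_zero]; positivity)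
  have h1 : n.choose 2 < n ^ 2 := Nat.choose_lt_pow (by omega) le_rfl
  have h2 : n ^ 2 ≤ n ^ c := Nat.pow_le_pow_right (by omega) hc
  omega

/-- **The window is load-bearing**: the crux with the centrality hypothesis dropped (`SliceTargetWithoutCentral` in the
work file) is FALSE (at both ends; the bottom end kills exponent `0`). [folklore] -/
theorem sliceTarget_false_without_central :
    ¬ ∀ c : ℕ, ∃ k : ℕ, 3 ≤ k ∧ ∃ δ : ℝ, 0 < δ ∧ SliceLBNoWindow c k δ := by
  intro h
  obtain ⟨k, hk, δ, hδ, H⟩ := h 0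
  exact not_sliceLBNoWindow_bottom 0 (by omega) hδ.le H

/-- **Accuracy is load-bearing** (trivially: `x_e` is a monotone circuit with no gate; `SliceTargetWithoutAccuracy` in
the work file). [folklore] -/
theorem sliceTarget_false_without_accuracy :
    ¬ ∀ c : ℕ, ∃ k : ℕ, 3 ≤ k ∧ ∀ᶠ n : ℕ in atTop, ∀ j : ℕ, Central k n j →
      ∀ C : Circuit (Edge n), C.IsOver monotoneBasis → n ^ c < C.size := by
  intro h
  obtain ⟨k, -, hev⟩ := h 0
  obtain ⟨n, hn, hn2⟩ := (hev.and (eventually_ge_atTop 2)).exists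
  obtain ⟨e₀⟩ := exists_edge hn2
  have hlt := hn (thr k n) (central_thr k n) (Circuit.input e₀) (input_isOver e₀ _)
  rw [Circuit.size_input] at hlt
  exact Nat.not_lt_zero _ hlt

/-! ### The guard `3 ≤ k` is redundant: `k ≤ 2` never witnesses -/

/-- `thr 2 n = 0`: for `k = 2` the threshold `⌊C(n,2)·n^{-2}⌋₊` vanishes (`C(n,2) < n²`). [folklore] -/
theorem thr_two (n : ℕ) : thr 2 n = 0 := by
  rw [thr]
  apply Nat.floor_eq_zero.2
  rcases Nat.eq_zero_or_pos n with rfl | hn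
  · simp
  have hn0 : (0 : ℝ) < n := by exact_mod_cast hn
  have hpow : (n : ℝ) ^ (-(2 : ℝ) / (((2 : ℕ) : ℝ) - 1)) = ((n : ℝ) ^ 2)⁻¹ := by
    rw [show (((2 : ℕ) : ℝ) - 1) = 1 by norm_num, div_one, Real.rpow_neg hn0.le, Real.rpow_two]
  rw [hpow]
  have hN : ((n.choose 2 : ℕ) : ℝ) < (n : ℝ) ^ 2 := by
    exact_mod_cast Nat.choose_lt_pow (by omega) le_rfl
  rw [mul_inv_lt_iff₀ (by positivity)]
  simpa using hN

/-- For `k = 2` the only central edge count is `j = 0`. [folklore] -/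
theorem central_two_iff {n j : ℕ} : Central 2 n j ↔ j = 0 := by
  rw [Central, thr_two, Nat.cast_zero, sub_zero, Nat.abs_cast, Real.zero_rpow (by norm_num), Nat.cast_nonpos]

/-- **`k = 2` cannot witness** (any `c`, any `δ ≥ 0`): the central window is the single slice `j = 0`, where
`x_e` is exact. [folklore] -/
theorem not_sliceLB_two (c : ℕ) {δ : ℝ} (hδ : 0 ≤ δ) : ¬ SliceLB c 2 δ := by
  intro H
  obtain ⟨n, hn, hn2⟩ := (H.and (eventually_ge_atTop 2)).exists
  obtain ⟨e₀⟩ := exists_edge hn2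
  have hexact : ∀ x : Edge n → Bool, edgeCount x = 0 → (Circuit.input e₀).eval x = cliqueFn n 2 x := by
    intro x hx
    rw [eq_false_of_edgeCount_eq_zero hx, Circuit.eval_input, cliqueFn_false le_rfl]
  have hlt := hn 0 (central_two_iff.2 rfl) (Circuit.input e₀) (input_isOver e₀ _)
    (by rw [errSet_eq_empty_of hexact, card_empty, Nat.cast_zero]; positivity)
  rw [Circuit.size_input] at hlt
  exact Nat.not_lt_zero _ hlt

/-- `thr 1 n = C(n,2)`: for `k = 1` the exponent `-2/(k-1)` is the junk value `-2/0 = 0`. [folklore] -/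
theorem thr_one (n : ℕ) : thr 1 n = n.choose 2 := by
  rw [thr, Nat.cast_one, sub_self, div_zero, Real.rpow_zero, mul_one, Nat.floor_natCast]

/-- **`k = 1` cannot witness**: the central slice `j = C(n,2)` is `{K_n}`, where `x_e = 1 = CLIQUE_1`. [folklore] -/
theorem not_sliceLB_one (c : ℕ) {δ : ℝ} (hδ : 0 ≤ δ) : ¬ SliceLB c 1 δ := by
  intro H
  obtain ⟨n, hn, hn2⟩ := (H.and (eventually_ge_atTop 2)).exists
  obtain ⟨e₀⟩ := exists_edge hn2
  have hexact : ∀ x : Edge n → Bool, edgeCount x = n.choose 2 →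
      (Circuit.input e₀).eval x = cliqueFn n 1 x := by
    intro x hx
    rw [eq_true_of_edgeCount_eq hx, Circuit.eval_input, cliqueFn_true (by omega : 1 ≤ n)]
  have hc : Central 1 n (n.choose 2) := by rw [← thr_one n]; exact central_thr 1 n
  have hlt := hn (n.choose 2) hc (Circuit.input e₀) (input_isOver e₀ _)
    (by rw [errSet_eq_empty_of hexact, card_empty, Nat.cast_zero]; positivity)
  rw [Circuit.size_input] at hlt
  exact Nat.not_lt_zero _ hlt

/-- `thr 0 n = C(n,2)·n²`: for `k = 0` the exponent is `-2/(0-1) = 2`. [folklore] -/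
theorem thr_zero (n : ℕ) : thr 0 n = n.choose 2 * n ^ 2 := by
  rw [thr, Nat.cast_zero, zero_sub, show (-(2 : ℝ)) / (-1) = 2 by norm_num, Real.rpow_two]
  exact_mod_cast Nat.floor_natCast (R := ℝ) (n.choose 2 * n ^ 2)

/-- **`k = 0` cannot witness** (any real `δ`): the central slice `j = C(n,2)·n² > C(n,2)` is EMPTY (`n ≥ 2`), so
every circuit is vacuously accurate there and `x_e` (no gates) violates the conclusion. [folklore] -/
theorem not_sliceLB_zero (c : ℕ) (δ : ℝ) : ¬ SliceLB c 0 δ := by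
  intro H
  obtain ⟨n, hn, hn2⟩ := (H.and (eventually_ge_atTop 2)).exists
  obtain ⟨e₀⟩ := exists_edge hn2
  have hN : 0 < n.choose 2 := Nat.choose_pos hn2
  have hempty : #(slice n (thr 0 n)) = 0 := by
    refine card_slice_eq_zero ?_
    rw [thr_zero]
    have h4 : 4 ≤ n ^ 2 := by nlinarith
    nlinarith
  have herr : (#(errSet n 0 (thr 0 n) (Circuit.input e₀)) : ℝ) ≤ δ * #(slice n (thr 0 n)) := by
    have h0 : #(errSet n 0 (thr 0 n) (Circuit.input e₀)) = 0 := by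
      have hle := card_le_card (errSet_subset_slice n 0 (thr 0 n) (Circuit.input e₀))
      omega
    rw [h0, hempty, Nat.cast_zero, mul_zero]
  have hlt := hn (thr 0 n) (central_thr 0 n) (Circuit.input e₀) (input_isOver e₀ _) herr
  rw [Circuit.size_input] at hlt
  exact Nat.not_lt_zero _ hlt

/-- **The guard `3 ≤ k` is redundant**: every `(k, δ)` with `δ ≥ 0` that satisfies the inner clause at any
exponent already has `k ≥ 3`. [folklore] -/
theorem three_le_of_sliceLB {c k : ℕ} {δ : ℝ} (hδ : 0 ≤ δ) (H : SliceLB c k δ) : 3 ≤ k := by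
  by_contra hk
  interval_cases k
  · exact not_sliceLB_zero c δ H
  · exact not_sliceLB_one c hδ H
  · exact not_sliceLB_two c hδ H



end Summit.PneNP.PneNP.Theorems.SliceTarget.Negative
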